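import Summits.HodgeConjecture.HodgeConjecture.Theses.HeckePrymWeil
import HarnessLib

/-!
# Crux `WeilTwelvefoldsSqrtMinus7` (stmt-HodgeConjecture-1261) — glue from the split fourteenfold rung

The hand-back of line `amnesic-secant-sheaves-split-fourteenfolds` (lead, 2026-08-16): its hardest stub
`stub_hyperbolicFourteenfolds` is, token for token, the route's split-rung predicate `X′(7, 7)` ("Hodge–Weil
classes are algebraic on every SPLIT = hyperbolic polarised `ℚ(√-7)`-Weil abelian 14-fold", the binders of
items `HyperbolicEightfoldsSqrtMinus7` / `AimedDescending` of `Theses/HeckePrymWeil.lean` rev 18 with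
`8 ↦ 14`, `4 ↦ 7`), and together with the route's lever `AimedDescending` (stmt-HodgeConjecture-14643) at
`(p, n) = (7, 6)` it gives the crux — pure logic, exactly as `EightfoldDescentGlue` (stmt-14751) one Witt
step down. This file proves that glue, with the split fourteenfold statement spelled out (it is not yet a
route declaration).
-/

noncomputable section

set_option linter.dupNamespace false

open CategoryTheory Complex
open Literature.AlgebraicGeometry Literature.AlgebraicGeometry.Motives
  Literature.AlgebraicGeometry.HodgeTheory Literature.AlgebraicTopology.SingularHomology
open Summit.HodgeConjecture.HodgeConjecture.Theses.HeckePrymWeil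

namespace Summit.HodgeConjecture.HodgeConjecture.Theorems.WeilTwelvefoldsSqrtMinus7.AmnesicSecantSheaves

/-- **Glue: split ℚ(√-7)-Weil fourteenfolds + aimed descending ⟹ `WeilTwelvefoldsSqrtMinus7`.** If the
Hodge–Weil classes are algebraic on every complex abelian 14-fold `X` with `ψ ≫ ψ = -7` that is of
hyperbolic Weil type for the `K`-symmetrised hyperplane class `7·e^*a + ψ^*e^*a` of a projective embedding
(the statement of the line's stub `stub_hyperbolicFourteenfolds` = the route's `X′(7,7)`), and the route's
lever `AimedDescending` holds, then the Hodge–Weil classes are algebraic on EVERY `ℚ(√-7)`-Weil abelian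
12-fold (the crux, all discriminants): instantiate `AimedDescending` at `(p, n) = (7, 6)`; its split-rung
hypothesis at `m = 7` is the fourteenfold statement up to `2·7 = 14`, `((7:ℕ):ℤ) = 7`, `((7:ℕ):ℂ) = 7`,
`√((7:ℕ):ℝ) = √7`. [cite: Markman2025SurveySecant, §11.5 Step 2] -/
theorem weilTwelvefolds_of_splitFourteenfolds_of_aimedDescending
    (h14 : ∀ (X : AbelianVariety ℂ) (ψ : X ⟶ X), X.dim = 14 → ψ ≫ ψ = -((7 : ℤ) • 𝟙 X) →
      ∀ (e : ProjectiveEmbedding X.X) (a : complexBetti (projectiveSpace e.n ℂ) 2),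
        IsRationalClass a → a ≠ 0 →
        IsHyperbolicWeilType X ψ 7
          ((7 : ℂ) • complexBetti.map e.ι 2 a + complexBetti.map ψ.hom.hom.hom 2 (complexBetti.map e.ι 2 a)) →
      ∀ c : complexBetti X.X 14, IsRationalClass c → IsOfHodgeType 14 X.X 14 7 7 c →
        c ∈ Module.End.eigenspace (complexBetti.map (𝟙 X + ψ).hom.hom.hom 14).hom
              ((1 + Complex.I * (Real.sqrt (7 : ℝ) : ℂ)) ^ 14) ⊔
            Module.End.eigenspace (complexBetti.map (𝟙 X + ψ).hom.hom.hom 14).hom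
              ((1 - Complex.I * (Real.sqrt (7 : ℝ) : ℂ)) ^ 14) →
        c ∈ algebraicClasses X.X 7)
    (hAD : AimedDescending) : WeilTwelvefoldsSqrtMinus7 := by
  intro A φ hA hφ c hrat hH hW
  have key := hAD 7 (by norm_num) (by norm_num) le_rfl 6 (by norm_num)
  refine key ?_ A φ hA (by simpa using hφ) c hrat hH (by simpa using hW)
  intro m hm X ψ hX hψ e a ha ha0 hhyp u hu huH huW
  subst hm
  have hψ' : ψ ≫ ψ = -((7 : ℤ) • 𝟙 X) := by simpa using hψ
  have hhyp' : IsHyperbolicWeilType X ψ 7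
      ((7 : ℂ) • complexBetti.map e.ι 2 a + complexBetti.map ψ.hom.hom.hom 2 (complexBetti.map e.ι 2 a)) := by
    simpa using hhyp
  have huW' : u ∈ Module.End.eigenspace (complexBetti.map (𝟙 X + ψ).hom.hom.hom 14).hom
        ((1 + Complex.I * (Real.sqrt (7 : ℝ) : ℂ)) ^ 14) ⊔
      Module.End.eigenspace (complexBetti.map (𝟙 X + ψ).hom.hom.hom 14).hom
        ((1 - Complex.I * (Real.sqrt (7 : ℝ) : ℂ)) ^ 14) := by
    simpa using huW
  simpa using h14 X ψ hX hψ' e a ha ha0 hhyp' u hu huH huW'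

end Summit.HodgeConjecture.HodgeConjecture.Theorems.WeilTwelvefoldsSqrtMinus7.AmnesicSecantSheaves

end
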